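import Summits.ResolutionOfSingularities.ResolutionOfSingularities.Theorems.HomologicalConductorNoZenoSplitExcCount
import Mathlib.FieldTheory.PurelyInseparable.Basic
import HarnessLib

/-!
# Crux `NoZenoR` / `NoZeno` (stmt-ResolutionOfSingularities-19943 / -16483), β2 descent, `stub_L1wCore` brick (c4):
# THE WEIGHT LEMMA — the split weight does not grow when the base residue field grows algebraically

OURS (cell res-hironaka, chain W4.4; stub worker res-L0-w44-stub-2 g11; consumer-side plan `L1W-PREP.md`
4a61d05beab993ff §3.1 BC-2 / the `hw` binder «weight does not grow» of res-D-pv-039's COUNT-DROP ARITHMETIC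
`…NoZenoSplitCountDrop.lean`).  Nothing here is a statement of the manuscript under review; pure field theory over
Mathlib; AI-written, weaker than expert review.

U8's split weight of an integral exceptional curve `E` of a resolution of a local ring with residue field `κ` is
`w_κ(E) = max 1 [L_E : κ]`, `L_E := κ^sep ∩ κ(E)` the separable-algebraic closure of `κ` in the function field
`F = κ(E)` (`ExcCount.splitWeight`).  When the SAME curve (same function field `F`) is viewed over a larger residue
field `κ ⊆ κ' ⊆ F` with `κ'/κ` ALGEBRAIC — the strict transform `Ē ≅ E` as an exceptional curve of the NEXT germ,
whose residue field `κ' = κ(y)` is finite over `κ` — its weight is `w_(κ')(E) = max 1 [L'_E : κ']` with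
`L'_E := κ'^sep ∩ F`.  The lemma: **`L'_E = L_E·κ'` (Mathlib `separableClosure.adjoin_eq_of_isAlgebraic`), hence
`[L'_E : κ'] ≤ [L_E : κ]` (Mathlib `IntermediateField.adjoin_rank_le_of_isAlgebraic_left`) and the weight does not
grow**; it DROPS exactly when `κ'` is not linearly disjoint from `L_E` over `κ` (the non-split-node mechanism of
res-L0-w44-idea-2's NS-A₂ / tri-1 TRIAGE v6.6 §28.3: `w` goes `2 → 1` while the curve count stays `1 → 1`).

* `rank_separableClosure_le_of_isAlgebraic` — cardinal form, `κ'/κ` algebraic;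
* `finrank_separableClosure_le` — natural-number form, `κ'/κ` finite-dimensional (the finite case transfers, the
  infinite case is `0 ≤ 0` by Mathlib's junk value, which a finite `κ'/κ` preserves);
* `max_one_finrank_separableClosure_le` — the `max 1`-guarded form = the shape of `ExcCount.splitWeight`.
-/

noncomputable section

-- single-problem summit: the doubled namespace component `ResolutionOfSingularities` is forced
set_option linter.dupNamespace false

namespace Summit.ResolutionOfSingularities.ResolutionOfSingularities.Theorems.NoZeno.ExcCount

open IntermediateField

variable (κ κ' F : Type*) [Field κ] [Field κ'] [Field F] [Algebra κ κ'] [Algebra κ F] [Algebra κ' F]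
  [IsScalarTower κ κ' F]

/-- **The separable constant field over a larger algebraic base is the compositum**: for a tower `F / κ' / κ` with
`κ'/κ` algebraic, `rank_(κ') (κ'^sep ∩ F) ≤ rank_κ (κ^sep ∩ F)` — because `κ'^sep ∩ F = κ'·(κ^sep ∩ F)`
(`separableClosure.adjoin_eq_of_isAlgebraic`) and adjoining to an algebraic extension does not increase the rank
(`adjoin_rank_le_of_isAlgebraic_left`). [this work] -/
theorem rank_separableClosure_le_of_isAlgebraic [Algebra.IsAlgebraic κ κ'] :
    Module.rank κ' (separableClosure κ' F) ≤ Module.rank κ (separableClosure κ F) := by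
  rw [← separableClosure.adjoin_eq_of_isAlgebraic (F := κ) (E := κ') (K := F)]
  exact adjoin_rank_le_of_isAlgebraic_left κ' (separableClosure κ F)

/-- **THE WEIGHT LEMMA, `finrank` form**: for a tower `F / κ' / κ` with `κ'/κ` finite-dimensional,
`[κ'^sep ∩ F : κ'] ≤ [κ^sep ∩ F : κ]` as natural numbers (`Module.finrank`; when `κ^sep ∩ F` is infinite-dimensional
over `κ`, so is `κ'^sep ∩ F ⊇ κ^sep ∩ F` over the finite extension `κ'` of `κ`, and both sides are the junk value `0`).
[this work] -/
theorem finrank_separableClosure_le [FiniteDimensional κ κ'] :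
    Module.finrank κ' (separableClosure κ' F) ≤ Module.finrank κ (separableClosure κ F) := by
  by_cases hfin : FiniteDimensional κ (separableClosure κ F)
  · -- finite case: compare ranks and convert
    have h := rank_separableClosure_le_of_isAlgebraic κ κ' F
    have hlt : Module.rank κ (separableClosure κ F) < Cardinal.aleph0 := Module.rank_lt_aleph0 κ _
    have hlt' : Module.rank κ' (separableClosure κ' F) < Cardinal.aleph0 := lt_of_le_of_lt h hlt
    rw [← Cardinal.toNat_le_iff_le_of_lt_aleph0 hlt' hlt] at h
    simpa [Module.finrank] using h
  · -- infinite case: the right-hand side is `0`; so is the left-hand side, since `κ^sep ∩ F ⊆ κ'^sep ∩ F` is then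
    -- infinite-dimensional over `κ`, hence over the finite extension `κ'`
    rw [Module.finrank_of_not_finite hfin]
    have hinf : ¬ FiniteDimensional κ' (separableClosure κ' F) := by
      intro hfin'
      apply hfin
      -- `separableClosure κ F` embeds `κ`-linearly into `separableClosure κ' F`, finite over `κ'`, finite over `κ`
      haveI : FiniteDimensional κ (separableClosure κ' F) := FiniteDimensional.trans κ κ' _
      let f : separableClosure κ F →ₗ[κ] separableClosure κ' F :=
        { toFun := fun x => ⟨(x : F), IsSeparable.tower_top κ' (mem_separableClosure_iff.mp x.2)⟩
          map_add' := fun x y => rfl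
          map_smul' := fun c x => by
            apply Subtype.ext
            change ((c • x : separableClosure κ F) : F) = c • ((x : separableClosure κ F) : F)
            rfl }
      have hf : Function.Injective f := by
        intro x y hxy
        apply Subtype.ext
        exact congrArg (fun z : separableClosure κ' F => (z : F)) hxy
      exact FiniteDimensional.of_injective f hf
    rw [Module.finrank_of_not_finite hinf]

/-- **THE WEIGHT LEMMA in the `max 1`-guarded shape of `ExcCount.splitWeight`**: for a tower `F / κ' / κ` with `κ'/κ`
finite-dimensional, `max 1 [κ'^sep ∩ F : κ'] ≤ max 1 [κ^sep ∩ F : κ]`. [this work] -/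
theorem max_one_finrank_separableClosure_le [FiniteDimensional κ κ'] :
    max 1 (Module.finrank κ' (separableClosure κ' F)) ≤ max 1 (Module.finrank κ (separableClosure κ F)) :=
  max_le_max le_rfl (finrank_separableClosure_le κ κ' F)

end Summit.ResolutionOfSingularities.ResolutionOfSingularities.Theorems.NoZeno.ExcCount

end
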